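import Literature.Analysis.FluidPDE.MildSolutionProofs
import Literature.Analysis.FluidPDE.HessianLaplacian
import HarnessLib

/-!
# The cut-off weight `ψ = χ_R² φ_{x₀}` of Seregin's Lemma B.6: definition and calculus

Analysis/FluidPDE definition-and-calculus file on the discharge path of the named fact
`Literature.Analysis.FluidPDE.seregin2014_limit_decay` (Seregin 2014, App. B, Thm. 1.6 /
Lemma B.6). The proof of Lemma B.6 (PDF p. 153) tests the local energy inequality (B.1.10) with
"`ψ = χ_R² φ_{x₀}`", where "`χ(x) = 0, x ∈ B(1)`, `χ(x) = 1, x ∉ B(2)`, `χ_R(x) = χ(x/R)`" and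
"`φ = 1` in `B(1)`, `spt φ ⊂ B(3/2)`, `φ_{x₀}(x) = φ(x − x₀)`", and uses throughout the bounds
`|∇χ_R| ≤ c/R`, `|∇²χ_R| ≤ c/R²`, `0 ≤ χ_R, φ ≤ 1` (estimates (B.2.8)–(B.2.13)). This file fixes
these objects over the tree's cut-off `cutoff R` (`WholeSpaceIBP.lean`: `= 1` on `B̄(0,R)`, `= 0`
off `B(0,2R)`, values in `[0,1]`, `‖D(cutoff R)‖ ≤ C/R`, `|Δ(cutoff R)| ≤ C/R²`) and a Mathlib
bump `φ₀ : ContDiffBump 0`: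

* `sereginWeight φ₀ R d x = (1 − cutoff R x)² · φ₀(d − x)` — DEFINITION of the weight
  (`χ_R := 1 − cutoff R`; the bump enters reflected, `φ₀(d − x)`, which keeps the tree's
  reflection–translation calculus `laplacian_comp_sub_left`, `fderiv_comp_sub_left_apply`
  applicable; for Mathlib's radial bumps it is `φ₀(x − d)`);
* **proved**: smoothness, `0 ≤ ψ ≤ χ_R² ≤ 1`, `ψ = 0` on `B̄(0,R)`, `ψ = χ_R²` on `B̄(d, rIn)`,
  `ψ = 0` off `B(d, rOut)` (compact support); the derivative formula
  `Dψ = χ_R² D(φ₀(d − ·)) + 2χ_R φ₀(d − ·) Dχ_R` (`Dχ_R = −D(cutoff R)`) with the bounds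
  `‖D(φ₀(d − ·))‖ ≤ B₁`, `‖D(cutoff R)‖ ≤ C/R` uniform in `d`; and the Laplacian bound
  `|Δψ| ≤ K (χ_R² + 1/R)` for `R ≥ 1`, `Δψ = 0` off `B̄(d, rOut)` — constants depending only on
  `φ₀`.

## References

* G. Seregin, *Lecture Notes on Regularity Theory for the Navier–Stokes Equations* (2014),
  doi:10.1142/9314, App. B, proof of Lemma B.6, PDF p. 153 (the test function `ψ = χ_R² φ_{x₀}`)
  and (B.2.8)–(B.2.13). Bib key `Seregin2014`.
-/

noncomputable section

open MeasureTheory TopologicalSpace Set Function Filter Metric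
open _root_.Topology
open scoped ENNReal NNReal RealInnerProductSpace Laplacian

namespace Literature.Analysis.FluidPDE

local notation "ℝ³" => EuclideanSpace ℝ (Fin 3)

/-! ### The weight -/

/-- **Seregin's cut-off weight** `ψ = χ_R² φ_{x₀}` (Seregin 2014, proof of Lemma B.6, PDF p. 153:
"For `ψ = χ_R² φ_{x₀}`, we find from inequality (B.1.10) …", `χ_R = χ(·/R)` vanishing on `B(R)`
and `= 1` off `B(2R)`, `φ_{x₀} = φ(· − x₀)` with `φ = 1` on `B(1)`, `spt φ ⊂ B(3/2)`), realised as
`(1 − cutoff R x)² · φ₀(d − x)` with the tree's cut-off `cutoff R` and a bump `φ₀` centred at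
`0` (radii `φ₀.rIn < φ₀.rOut` free; Lemma B.6 uses `rIn = 9/8`, `rOut = 5/4`).
[cite: Seregin2014, App. B, proof of Lemma B.6, PDF p. 153] -/
def sereginWeight (φ₀ : ContDiffBump (0 : ℝ³)) (R : ℝ) (d : ℝ³) (x : ℝ³) : ℝ :=
  (1 - cutoff R x) ^ 2 * φ₀ (d - x)

variable (φ₀ : ContDiffBump (0 : ℝ³))

/-- Unfolding the weight. [folklore] -/
theorem sereginWeight_apply (R : ℝ) (d x : ℝ³) :
    sereginWeight φ₀ R d x = (1 - cutoff R x) ^ 2 * φ₀ (d - x) :=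
  rfl

/-- `0 ≤ 1 - cutoff R x ≤ 1`. [folklore] -/
theorem one_sub_cutoff_mem_Icc (R : ℝ) (x : ℝ³) : 1 - cutoff R x ∈ Icc (0 : ℝ) 1 :=
  ⟨sub_nonneg.2 (cutoff_le_one R x), sub_le_self _ (cutoff_nonneg R x)⟩

/-- The weight is smooth. [folklore] -/
theorem contDiff_sereginWeight (R : ℝ) (d : ℝ³) {n : ℕ∞} :
    ContDiff ℝ n (sereginWeight φ₀ R d) :=
  ((contDiff_const.sub (contDiff_cutoff R)).pow 2).mul
    (φ₀.contDiff.comp (contDiff_const.sub contDiff_id))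

/-- `0 ≤ ψ`. [folklore] -/
theorem sereginWeight_nonneg (R : ℝ) (d x : ℝ³) : 0 ≤ sereginWeight φ₀ R d x :=
  mul_nonneg (sq_nonneg _) (φ₀.nonneg)

/-- `ψ ≤ χ_R² = (1 − cutoff R)²`. [folklore] -/
theorem sereginWeight_le_sq (R : ℝ) (d x : ℝ³) :
    sereginWeight φ₀ R d x ≤ (1 - cutoff R x) ^ 2 :=
  mul_le_of_le_one_right (sq_nonneg _) φ₀.le_one

/-- `(1 − cutoff R)² ≤ 1`. [folklore] -/
theorem one_sub_cutoff_sq_le_one (R : ℝ) (x : ℝ³) : (1 - cutoff R x) ^ 2 ≤ 1 := by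
  have h := one_sub_cutoff_mem_Icc R x
  nlinarith [h.1, h.2]

/-- `ψ ≤ 1`. [folklore] -/
theorem sereginWeight_le_one (R : ℝ) (d x : ℝ³) : sereginWeight φ₀ R d x ≤ 1 :=
  (sereginWeight_le_sq φ₀ R d x).trans (one_sub_cutoff_sq_le_one R x)

/-- `ψ = 0` on the ball `‖x‖ ≤ R` (there `cutoff R = 1`). [folklore] -/
theorem sereginWeight_eq_zero_of_norm_le {R : ℝ} (hR : 0 < R) (d : ℝ³) {x : ℝ³} (hx : ‖x‖ ≤ R) :
    sereginWeight φ₀ R d x = 0 := by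
  simp [sereginWeight, cutoff_eq_one hR hx]

/-- `ψ = χ_R²` on `B̄(d, rIn)` (there the bump equals `1`). [folklore] -/
theorem sereginWeight_eq_sq_of_mem (R : ℝ) {d x : ℝ³} (hx : x ∈ closedBall d φ₀.rIn) :
    sereginWeight φ₀ R d x = (1 - cutoff R x) ^ 2 := by
  have h1 : φ₀ (d - x) = 1 := φ₀.one_of_mem_closedBall (by
    rw [mem_closedBall, dist_zero_right, norm_sub_rev]
    rwa [mem_closedBall, dist_eq_norm] at hx)
  rw [sereginWeight, h1, mul_one]

/-- `ψ = 0` off `B(d, rOut)` (there the bump vanishes). [folklore] -/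
theorem sereginWeight_eq_zero_of_not_mem (R : ℝ) {d x : ℝ³} (hx : x ∉ ball d φ₀.rOut) :
    sereginWeight φ₀ R d x = 0 := by
  have h0 : φ₀ (d - x) = 0 := by
    refine φ₀.zero_of_le_dist ?_
    rw [dist_zero_right, norm_sub_rev]
    rw [mem_ball, dist_eq_norm, not_lt] at hx
    exact hx
  rw [sereginWeight, h0, mul_zero]

/-- `tsupport ψ ⊆ B̄(d, rOut)`. [folklore] -/
theorem tsupport_sereginWeight_subset (R : ℝ) (d : ℝ³) :
    tsupport (sereginWeight φ₀ R d) ⊆ closedBall d φ₀.rOut :=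
  closure_minimal (fun x hx => by
      by_contra h
      exact hx (sereginWeight_eq_zero_of_not_mem φ₀ R fun h' => h (ball_subset_closedBall h')))
    isClosed_closedBall

/-- The weight has compact support. [folklore] -/
theorem hasCompactSupport_sereginWeight (R : ℝ) (d : ℝ³) :
    HasCompactSupport (sereginWeight φ₀ R d) :=
  HasCompactSupport.intro (isCompact_closedBall d φ₀.rOut) fun _x hx =>
    sereginWeight_eq_zero_of_not_mem φ₀ R fun h' => hx (ball_subset_closedBall h')

/-! ### The reflected bump `x ↦ φ₀(d − x)`: vanishing and bounds uniform in the centre -/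

/-- Off `B̄(d, rOut)` the reflected bump vanishes identically near the point. [folklore] -/
theorem bump_comp_sub_eventuallyEq_zero {d x : ℝ³} (hx : x ∉ closedBall d φ₀.rOut) :
    (fun y => φ₀ (d - y)) =ᶠ[𝓝 x] fun _ => (0 : ℝ) := by
  filter_upwards [isClosed_closedBall.isOpen_compl.mem_nhds hx] with y hy
  refine φ₀.zero_of_le_dist ?_
  rw [dist_zero_right, norm_sub_rev, ← dist_eq_norm]
  rw [mem_compl_iff, mem_closedBall, not_le] at hy
  exact hy.le

/-- Off `B̄(d, rOut)` the derivative of the reflected bump vanishes. [folklore] -/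
theorem fderiv_bump_comp_sub_eq_zero {d x : ℝ³} (hx : x ∉ closedBall d φ₀.rOut) :
    fderiv ℝ (fun y => φ₀ (d - y)) x = 0 := by
  rw [(bump_comp_sub_eventuallyEq_zero φ₀ hx).fderiv_eq]
  exact fderiv_const_apply 0

/-- Off `B̄(d, rOut)` the Laplacian of the reflected bump vanishes. [folklore] -/
theorem laplacian_bump_comp_sub_eq_zero {d x : ℝ³} (hx : x ∉ closedBall d φ₀.rOut) :
    (Δ fun y : ℝ³ => (φ₀ (d - y) : ℝ)) x = 0 := by
  rw [(InnerProductSpace.laplacian_congr_nhds (bump_comp_sub_eventuallyEq_zero φ₀ hx)).eq_of_nhds,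
    InnerProductSpace.laplacian_const]
  rfl

/-- **Uniform gradient bound for the bumps**: there is `B₁ ≥ 0` with `‖D(φ₀(d − ·))(x)‖ ≤ B₁` for
all centres `d` and points `x` (boundedness of the continuous compactly supported `Dφ₀`, and
`D(φ₀(d − ·))(x) = −Dφ₀(d − x)`). [folklore] -/
theorem exists_norm_fderiv_bump_comp_sub_le :
    ∃ B₁ : ℝ, 0 ≤ B₁ ∧ ∀ d x : ℝ³, ‖fderiv ℝ (fun y => φ₀ (d - y)) x‖ ≤ B₁ := by
  obtain ⟨C, hC⟩ := ((φ₀.contDiff (n := 1)).continuous_fderiv one_ne_zero)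
    |>.bounded_above_of_compact_support (φ₀.hasCompactSupport.fderiv (𝕜 := ℝ))
  have hφ1 : ContDiff ℝ 1 (φ₀ : ℝ³ → ℝ) := φ₀.contDiff
  refine ⟨max C 0, le_max_right _ _, fun d x => ?_⟩
  refine ContinuousLinearMap.opNorm_le_bound _ (le_max_right _ _) fun v => ?_
  rw [FunctionSpaces.fderiv_comp_sub_left_apply hφ1 d x v, norm_neg]
  calc ‖fderiv ℝ (φ₀ : ℝ³ → ℝ) (d - x) v‖ ≤ ‖fderiv ℝ (φ₀ : ℝ³ → ℝ) (d - x)‖ * ‖v‖ :=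
        ContinuousLinearMap.le_opNorm _ _
    _ ≤ max C 0 * ‖v‖ := by
        gcongr
        exact (hC _).trans (le_max_left _ _)

/-- **Uniform Laplacian bound for the bumps**: there is `B₂ ≥ 0` with `|Δ(φ₀(d − ·))(x)| ≤ B₂` for
all `d`, `x` (`Δ(φ₀(d − ·))(x) = (Δφ₀)(d − x)` and boundedness of the continuous compactly
supported `Δφ₀`). [folklore] -/
theorem exists_abs_laplacian_bump_comp_sub_le :
    ∃ B₂ : ℝ, 0 ≤ B₂ ∧ ∀ d x : ℝ³, |(Δ fun y : ℝ³ => (φ₀ (d - y) : ℝ)) x| ≤ B₂ := by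
  have hφ2 : ContDiff ℝ 2 (φ₀ : ℝ³ → ℝ) := φ₀.contDiff
  have hcs : HasCompactSupport (Δ (φ₀ : ℝ³ → ℝ)) := by
    refine HasCompactSupport.intro (isCompact_closedBall (0 : ℝ³) φ₀.rOut) fun x hx => ?_
    have hev : (φ₀ : ℝ³ → ℝ) =ᶠ[𝓝 x] fun _ => (0 : ℝ) := by
      filter_upwards [isClosed_closedBall.isOpen_compl.mem_nhds hx] with y hy
      refine φ₀.zero_of_le_dist ?_
      rw [mem_compl_iff, mem_closedBall, not_le] at hy
      exact hy.le
    rw [(InnerProductSpace.laplacian_congr_nhds hev).eq_of_nhds, InnerProductSpace.laplacian_const]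
    rfl
  obtain ⟨C, hC⟩ := (continuous_laplacian hφ2).bounded_above_of_compact_support hcs
  refine ⟨max C 0, le_max_right _ _, fun d x => ?_⟩
  rw [laplacian_comp_sub_left hφ2 d x]
  exact ((Real.norm_eq_abs _).symm.le.trans (hC _)).trans (le_max_left _ _)

/-! ### The cut-off factor `χ_R = 1 − cutoff R` -/

/-- `D(1 − cutoff R) = −D(cutoff R)`. [folklore] -/
theorem fderiv_one_sub_cutoff (R : ℝ) (x : ℝ³) :
    fderiv ℝ (fun y => 1 - cutoff R y) x = -fderiv ℝ (cutoff R) x :=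
  fderiv_const_sub 1

/-- `Δ(1 − cutoff R) = −Δ(cutoff R)`. [folklore] -/
theorem laplacian_one_sub_cutoff (R : ℝ) (x : ℝ³) :
    (Δ fun y : ℝ³ => (1 - cutoff R y : ℝ)) x = -(Δ (cutoff R : ℝ³ → ℝ)) x := by
  have e : (fun y : ℝ³ => (1 - cutoff R y : ℝ)) = (fun _ => (1 : ℝ)) - cutoff R := rfl
  rw [e, ContDiffAt.laplacian_sub contDiffAt_const ((contDiff_cutoff R (n := 2)).contDiffAt),
    InnerProductSpace.laplacian_const, Pi.zero_apply, zero_sub]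

/-- The derivative of `χ_R²`: `D(χ_R²) = 2χ_R Dχ_R`. [folklore] -/
theorem fderiv_one_sub_cutoff_sq (R : ℝ) (x : ℝ³) :
    fderiv ℝ (fun y => (1 - cutoff R y) ^ 2) x =
      (2 * (1 - cutoff R x)) • fderiv ℝ (fun y => 1 - cutoff R y) x := by
  have hd : DifferentiableAt ℝ (fun y => 1 - cutoff R y) x :=
    ((contDiff_const.sub (contDiff_cutoff R (n := 1))).differentiable one_ne_zero).differentiableAt
  have e : (fun y : ℝ³ => (1 - cutoff R y) ^ 2) = fun y => (1 - cutoff R y) * (1 - cutoff R y) :=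
    funext fun y => sq _
  rw [e, fderiv_fun_mul hd hd, two_mul, add_smul]

/-! ### The derivative of the weight -/

/-- **Derivative formula for the weight**:
`Dψ(x) = χ_R(x)² D(φ₀(d − ·))(x) + (2χ_R(x) φ₀(d − x)) Dχ_R(x)`, `Dχ_R = −D(cutoff R)`. [folklore] -/
theorem fderiv_sereginWeight (R : ℝ) (d x : ℝ³) :
    fderiv ℝ (sereginWeight φ₀ R d) x =
      (1 - cutoff R x) ^ 2 • fderiv ℝ (fun y => φ₀ (d - y)) x +
        (2 * (1 - cutoff R x) * φ₀ (d - x)) • fderiv ℝ (fun y => 1 - cutoff R y) x := by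
  have hdχ2 : DifferentiableAt ℝ (fun y => (1 - cutoff R y) ^ 2) x :=
    (((contDiff_const.sub (contDiff_cutoff R (n := 1))).pow 2).differentiable one_ne_zero).differentiableAt
  have hdb : DifferentiableAt ℝ (fun y => φ₀ (d - y)) x :=
    ((φ₀.contDiff (n := 1)).comp (contDiff_const.sub contDiff_id)).differentiable one_ne_zero x
  have e : sereginWeight φ₀ R d = fun y => (1 - cutoff R y) ^ 2 * φ₀ (d - y) := rfl
  rw [e, fderiv_fun_mul hdχ2 hdb, fderiv_one_sub_cutoff_sq, smul_smul]
  congr 1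
  ring_nf

/-- **Gradient bound for the weight**: with the bump bound `B₁` and the cut-off bound `C`,
`‖Dψ(x)‖ ≤ χ_R(x)² B₁ + 2χ_R(x) C/R` for `R > 0`. [folklore] -/
theorem norm_fderiv_sereginWeight_le {B₁ C R : ℝ} (hB₁ : ∀ d x : ℝ³, ‖fderiv ℝ (fun y => φ₀ (d - y)) x‖ ≤ B₁)
    (hC : ∀ x : ℝ³, ‖fderiv ℝ (cutoff R) x‖ ≤ C / R) (d x : ℝ³) :
    ‖fderiv ℝ (sereginWeight φ₀ R d) x‖ ≤
      (1 - cutoff R x) ^ 2 * B₁ + 2 * (1 - cutoff R x) * (C / R) := by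
  have hχ := one_sub_cutoff_mem_Icc R x
  rw [fderiv_sereginWeight]
  refine (norm_add_le _ _).trans (add_le_add ?_ ?_)
  · rw [norm_smul, Real.norm_eq_abs, abs_of_nonneg (sq_nonneg _)]
    exact mul_le_mul_of_nonneg_left (hB₁ d x) (sq_nonneg _)
  · have h2χ : (0 : ℝ) ≤ 2 * (1 - cutoff R x) := mul_nonneg zero_le_two hχ.1
    have hsc : (0 : ℝ) ≤ 2 * (1 - cutoff R x) * φ₀ (d - x) := mul_nonneg h2χ φ₀.nonneg
    rw [norm_smul, fderiv_one_sub_cutoff, norm_neg, Real.norm_eq_abs, abs_of_nonneg hsc]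
    calc 2 * (1 - cutoff R x) * φ₀ (d - x) * ‖fderiv ℝ (cutoff R) x‖
        ≤ 2 * (1 - cutoff R x) * 1 * (C / R) := by
          gcongr
          · exact φ₀.le_one
          · exact hC x
      _ = 2 * (1 - cutoff R x) * (C / R) := by ring

/-- Off `B̄(d, rOut)` the derivative of the weight vanishes. [folklore] -/
theorem fderiv_sereginWeight_eq_zero (R : ℝ) {d x : ℝ³} (hx : x ∉ closedBall d φ₀.rOut) :
    fderiv ℝ (sereginWeight φ₀ R d) x = 0 := by
  have h0 : φ₀ (d - x) = 0 :=
    (bump_comp_sub_eventuallyEq_zero φ₀ hx).self_of_nhds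
  rw [fderiv_sereginWeight, fderiv_bump_comp_sub_eq_zero φ₀ hx, h0, smul_zero, mul_zero,
    zero_smul, add_zero]

/-! ### The Laplacian of the weight -/

/-- **Laplacian bound for the weight** (the bounds `|Δψ| ≲ χ_R² + 1/R` behind (B.2.9)): there is
`K ≥ 0`, depending only on the bump, such that for all `R ≥ 1`, all centres `d` and all `x`,
`|Δψ(x)| ≤ K ((1 − cutoff R x)² + 1/R)`. Proof: the Leibniz rule
`Δ(fg) = fΔg + gΔf + 2Σᵢ ∂ᵢf ∂ᵢg` (`laplacian_mul_eq`) for `f = χ_R²`, `g = φ₀(d − ·)` and for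
`χ_R² = χ_R · χ_R`, with `|Δφ₀(d − ·)| ≤ B₂`, `‖Dφ₀(d − ·)‖ ≤ B₁`, `‖Dχ_R‖ ≤ C/R`,
`|Δχ_R| ≤ C₂/R²`, `0 ≤ χ_R, φ₀ ≤ 1` and `1/R² ≤ 1/R`. [folklore] -/
theorem exists_abs_laplacian_sereginWeight_le :
    ∃ K : ℝ, 0 ≤ K ∧ ∀ R : ℝ, 1 ≤ R → ∀ d x : ℝ³,
      |(Δ (sereginWeight φ₀ R d)) x| ≤ K * ((1 - cutoff R x) ^ 2 + 1 / R) := by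
  obtain ⟨B₁, hB₁0, hB₁⟩ := exists_norm_fderiv_bump_comp_sub_le φ₀
  obtain ⟨B₂, hB₂0, hB₂⟩ := exists_abs_laplacian_bump_comp_sub_le φ₀
  obtain ⟨C, hC0, hC⟩ := exists_norm_fderiv_cutoff_le (E := ℝ³)
  obtain ⟨C₂, hC₂0, hC₂⟩ := exists_abs_laplacian_cutoff_le (E := ℝ³)
  set b := EuclideanSpace.basisFun (Fin 3) ℝ with hb
  refine ⟨max B₂ (2 * C₂ + 6 * C ^ 2 + 12 * C * B₁), le_max_of_le_left hB₂0, fun R hR d x => ?_⟩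
  have hR0 : 0 < R := lt_of_lt_of_le one_pos hR
  have hχ := one_sub_cutoff_mem_Icc R x
  have hRinv : 1 / R ^ 2 ≤ 1 / R := by
    rw [div_le_div_iff₀ (by positivity) hR0, one_mul, one_mul]
    nlinarith
  -- smoothness of the factors
  have hχs : ContDiff ℝ 2 (fun y : ℝ³ => 1 - cutoff R y) := contDiff_const.sub (contDiff_cutoff R)
  have hχ2s : ContDiff ℝ 2 (fun y : ℝ³ => (1 - cutoff R y) ^ 2) := hχs.pow 2
  have hgs : ContDiff ℝ 2 (fun y : ℝ³ => φ₀ (d - y)) :=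
    (φ₀.contDiff (n := 2)).comp (contDiff_const.sub contDiff_id)
  -- derivative bounds along the basis vectors
  have hbn : ∀ i, ‖b i‖ = 1 := fun i => b.orthonormal.1 i
  have hdχ : ∀ i, |fderiv ℝ (fun y => 1 - cutoff R y) x (b i)| ≤ C / R := fun i => by
    have e : fderiv ℝ (fun y => 1 - cutoff R y) x (b i) = -(fderiv ℝ (cutoff R) x (b i)) := by
      rw [fderiv_one_sub_cutoff]; rfl
    rw [e, abs_neg, ← Real.norm_eq_abs]
    calc ‖fderiv ℝ (cutoff R) x (b i)‖ ≤ ‖fderiv ℝ (cutoff R) x‖ * ‖b i‖ :=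
          ContinuousLinearMap.le_opNorm _ _
      _ ≤ C / R * 1 := by rw [hbn]; exact mul_le_mul_of_nonneg_right (hC R hR0 x) zero_le_one
      _ = C / R := mul_one _
  have hdg : ∀ i, |fderiv ℝ (fun y => φ₀ (d - y)) x (b i)| ≤ B₁ := fun i => by
    rw [← Real.norm_eq_abs]
    calc ‖fderiv ℝ (fun y => φ₀ (d - y)) x (b i)‖
        ≤ ‖fderiv ℝ (fun y => φ₀ (d - y)) x‖ * ‖b i‖ := ContinuousLinearMap.le_opNorm _ _
      _ ≤ B₁ * 1 := by rw [hbn]; exact mul_le_mul_of_nonneg_right (hB₁ d x) zero_le_one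
      _ = B₁ := mul_one _
  have hdχ2 : ∀ i, |fderiv ℝ (fun y => (1 - cutoff R y) ^ 2) x (b i)| ≤ 2 * (C / R) := fun i => by
    have e : fderiv ℝ (fun y => (1 - cutoff R y) ^ 2) x (b i) =
        2 * (1 - cutoff R x) * fderiv ℝ (fun y => 1 - cutoff R y) x (b i) := by
      rw [fderiv_one_sub_cutoff_sq]; rfl
    rw [e, abs_mul, abs_mul, abs_two, abs_of_nonneg hχ.1]
    calc 2 * (1 - cutoff R x) * |fderiv ℝ (fun y => 1 - cutoff R y) x (b i)|
        ≤ 2 * 1 * (C / R) := by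
          gcongr
          · exact hχ.2
          · exact hdχ i
      _ = 2 * (C / R) := by ring
  -- the Laplacian of `χ_R²`
  have hΔχ : |(Δ fun y : ℝ³ => (1 - cutoff R y : ℝ)) x| ≤ C₂ / R ^ 2 := by
    rw [laplacian_one_sub_cutoff, abs_neg]; exact hC₂ R hR0 x
  have hΔχ2 : |(Δ fun y : ℝ³ => ((1 - cutoff R y) ^ 2 : ℝ)) x| ≤ 2 * (C₂ / R ^ 2) + 6 * (C / R) ^ 2 := by
    have e : (fun y : ℝ³ => (1 - cutoff R y) ^ 2) = fun y => (1 - cutoff R y) * (1 - cutoff R y) :=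
      funext fun y => sq _
    rw [e, laplacian_mul_eq b hχs hχs x]
    have h1 : |(1 - cutoff R x) * (Δ fun y : ℝ³ => (1 - cutoff R y : ℝ)) x| ≤ C₂ / R ^ 2 := by
      rw [abs_mul, abs_of_nonneg hχ.1]
      calc (1 - cutoff R x) * |(Δ fun y : ℝ³ => (1 - cutoff R y : ℝ)) x| ≤ 1 * (C₂ / R ^ 2) :=
            mul_le_mul hχ.2 hΔχ (abs_nonneg _) zero_le_one
        _ = C₂ / R ^ 2 := one_mul _
    have h2 : |2 * ∑ i, fderiv ℝ (fun y => 1 - cutoff R y) x (b i) *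
        fderiv ℝ (fun y => 1 - cutoff R y) x (b i)| ≤ 6 * (C / R) ^ 2 := by
      rw [abs_mul, abs_two]
      have : |∑ i, fderiv ℝ (fun y => 1 - cutoff R y) x (b i) *
          fderiv ℝ (fun y => 1 - cutoff R y) x (b i)| ≤ 3 * (C / R) ^ 2 := by
        refine (Finset.abs_sum_le_sum_abs _ _).trans ?_
        calc ∑ i, |fderiv ℝ (fun y => 1 - cutoff R y) x (b i) *
              fderiv ℝ (fun y => 1 - cutoff R y) x (b i)|
            ≤ ∑ _i : Fin 3, (C / R) ^ 2 := Finset.sum_le_sum fun i _ => by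
                rw [abs_mul, sq]
                exact mul_le_mul (hdχ i) (hdχ i) (abs_nonneg _) (by positivity)
          _ = 3 * (C / R) ^ 2 := by simp
      linarith
    calc |(1 - cutoff R x) * (Δ fun y : ℝ³ => (1 - cutoff R y : ℝ)) x +
          (1 - cutoff R x) * (Δ fun y : ℝ³ => (1 - cutoff R y : ℝ)) x +
          2 * ∑ i, fderiv ℝ (fun y => 1 - cutoff R y) x (b i) *
            fderiv ℝ (fun y => 1 - cutoff R y) x (b i)|
        ≤ |(1 - cutoff R x) * (Δ fun y : ℝ³ => (1 - cutoff R y : ℝ)) x| +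
          |(1 - cutoff R x) * (Δ fun y : ℝ³ => (1 - cutoff R y : ℝ)) x| +
          |2 * ∑ i, fderiv ℝ (fun y => 1 - cutoff R y) x (b i) *
            fderiv ℝ (fun y => 1 - cutoff R y) x (b i)| :=
            (abs_add_le _ _).trans (add_le_add (abs_add_le _ _) le_rfl)
      _ ≤ C₂ / R ^ 2 + C₂ / R ^ 2 + 6 * (C / R) ^ 2 := add_le_add (add_le_add h1 h1) h2
      _ = 2 * (C₂ / R ^ 2) + 6 * (C / R) ^ 2 := by ring
  -- the Leibniz rule for `ψ = χ_R² · φ₀(d − ·)`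
  have e : sereginWeight φ₀ R d = fun y => (1 - cutoff R y) ^ 2 * φ₀ (d - y) := rfl
  rw [e, laplacian_mul_eq b hχ2s hgs x]
  have t1 : |(1 - cutoff R x) ^ 2 * (Δ fun y : ℝ³ => (φ₀ (d - y) : ℝ)) x| ≤ (1 - cutoff R x) ^ 2 * B₂ := by
    rw [abs_mul, abs_of_nonneg (sq_nonneg _)]
    exact mul_le_mul_of_nonneg_left (hB₂ d x) (sq_nonneg _)
  have t2 : |φ₀ (d - x) * (Δ fun y : ℝ³ => ((1 - cutoff R y) ^ 2 : ℝ)) x| ≤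
      2 * (C₂ / R ^ 2) + 6 * (C / R) ^ 2 := by
    rw [abs_mul, abs_of_nonneg φ₀.nonneg]
    calc φ₀ (d - x) * |(Δ fun y : ℝ³ => ((1 - cutoff R y) ^ 2 : ℝ)) x|
        ≤ 1 * (2 * (C₂ / R ^ 2) + 6 * (C / R) ^ 2) :=
          mul_le_mul φ₀.le_one hΔχ2 (abs_nonneg _) zero_le_one
      _ = 2 * (C₂ / R ^ 2) + 6 * (C / R) ^ 2 := one_mul _
  have t3 : |2 * ∑ i, fderiv ℝ (fun y => (1 - cutoff R y) ^ 2) x (b i) *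
      fderiv ℝ (fun y => φ₀ (d - y)) x (b i)| ≤ 12 * (C / R) * B₁ := by
    rw [abs_mul, abs_two]
    have : |∑ i, fderiv ℝ (fun y => (1 - cutoff R y) ^ 2) x (b i) *
        fderiv ℝ (fun y => φ₀ (d - y)) x (b i)| ≤ 3 * (2 * (C / R) * B₁) := by
      refine (Finset.abs_sum_le_sum_abs _ _).trans ?_
      calc ∑ i, |fderiv ℝ (fun y => (1 - cutoff R y) ^ 2) x (b i) *
            fderiv ℝ (fun y => φ₀ (d - y)) x (b i)|
          ≤ ∑ _i : Fin 3, 2 * (C / R) * B₁ := Finset.sum_le_sum fun i _ => by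
              rw [abs_mul]
              exact mul_le_mul (hdχ2 i) (hdg i) (abs_nonneg _) (by positivity)
        _ = 3 * (2 * (C / R) * B₁) := by simp
    linarith
  have hsum : |(1 - cutoff R x) ^ 2 * (Δ fun y : ℝ³ => (φ₀ (d - y) : ℝ)) x +
        φ₀ (d - x) * (Δ fun y : ℝ³ => ((1 - cutoff R y) ^ 2 : ℝ)) x +
        2 * ∑ i, fderiv ℝ (fun y => (1 - cutoff R y) ^ 2) x (b i) *
          fderiv ℝ (fun y => φ₀ (d - y)) x (b i)| ≤
      (1 - cutoff R x) ^ 2 * B₂ + (2 * (C₂ / R ^ 2) + 6 * (C / R) ^ 2) + 12 * (C / R) * B₁ :=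
    ((abs_add_le _ _).trans (add_le_add (abs_add_le _ _) le_rfl)).trans
      (add_le_add (add_le_add t1 t2) t3)
  refine hsum.trans ?_
  -- collect: `χ² B₂ + (1/R)(2C₂ + 6C² + 12 C B₁)` using `1/R² ≤ 1/R ≤ 1`
  have hK1 : B₂ ≤ max B₂ (2 * C₂ + 6 * C ^ 2 + 12 * C * B₁) := le_max_left _ _
  have hK2 : 2 * C₂ + 6 * C ^ 2 + 12 * C * B₁ ≤ max B₂ (2 * C₂ + 6 * C ^ 2 + 12 * C * B₁) :=
    le_max_right _ _
  have hR1 : 1 / R ≤ 1 := by rw [div_le_one hR0]; exact hR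
  have hsq : (C / R) ^ 2 = C ^ 2 * (1 / R ^ 2) := by ring
  have hlin : C / R = C * (1 / R) := by ring
  calc (1 - cutoff R x) ^ 2 * B₂ + (2 * (C₂ / R ^ 2) + 6 * (C / R) ^ 2) + 12 * (C / R) * B₁
      = (1 - cutoff R x) ^ 2 * B₂ +
          (2 * C₂ * (1 / R ^ 2) + 6 * C ^ 2 * (1 / R ^ 2) + 12 * C * B₁ * (1 / R)) := by ring
    _ ≤ (1 - cutoff R x) ^ 2 * B₂ +
          (2 * C₂ * (1 / R) + 6 * C ^ 2 * (1 / R) + 12 * C * B₁ * (1 / R)) := by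
        gcongr
    _ = (1 - cutoff R x) ^ 2 * B₂ + (2 * C₂ + 6 * C ^ 2 + 12 * C * B₁) * (1 / R) := by ring
    _ ≤ (1 - cutoff R x) ^ 2 * max B₂ (2 * C₂ + 6 * C ^ 2 + 12 * C * B₁) +
          max B₂ (2 * C₂ + 6 * C ^ 2 + 12 * C * B₁) * (1 / R) := by
        gcongr
    _ = max B₂ (2 * C₂ + 6 * C ^ 2 + 12 * C * B₁) * ((1 - cutoff R x) ^ 2 + 1 / R) := by ring

/-- Off `B̄(d, rOut)` the Laplacian of the weight vanishes. [folklore] -/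
theorem laplacian_sereginWeight_eq_zero (R : ℝ) {d x : ℝ³} (hx : x ∉ closedBall d φ₀.rOut) :
    (Δ (sereginWeight φ₀ R d)) x = 0 := by
  have hev : sereginWeight φ₀ R d =ᶠ[𝓝 x] fun _ => (0 : ℝ) := by
    filter_upwards [bump_comp_sub_eventuallyEq_zero φ₀ hx] with y hy
    rw [sereginWeight_apply, hy, mul_zero]
  rw [(InnerProductSpace.laplacian_congr_nhds hev).eq_of_nhds, InnerProductSpace.laplacian_const]
  rfl

end Literature.Analysis.FluidPDE

end
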